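import Literature.MathematicalPhysics.QuantumManyBody.GroundState
import Literature.MathematicalPhysics.QuantumManyBody.BoseGasDirichletMonotonicity
import Summits.AtomisticToContinuum.BoseEinsteinCondensation.Theorems.BECCutLineWeakDisorderGroundStateRigidityHardCoreOfConnected
import HarnessLib

/-!
# Crux `GroundStateRigidity` (stmt-AtomisticToContinuum-9072), line `Sketch` (skeleton v9):
# helpers for the registered stub `stub_sectorExclusion` (Stub C) — `C¹` surgery along clopen sets

Supports (does not close) stmt-AtomisticToContinuum-9072; first auxiliary file of stub
`stub_sectorExclusion` of line Sketch (lead c5), namespace `GroundStateRigidity.SectorExclusion`.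

Contents (all elementary):

* `hasFDerivAt_indicator`, `continuous_indicator_of_cover`, `contDiff_indicator` — the CLOPEN
  SURGERY LEMMA: if `f` is `C¹`, `Q` and `R` are disjoint open sets and `f` together with
  `fderiv ℝ f` vanishes at every point outside `Q ∪ R`, then `Q.indicator f` is again `C¹` with
  `fderiv (Q.indicator f) = Q.indicator (fderiv f)` (near `Q` it is `f`, near `R` it is `0`, and
  at a point `x` of the rest `‖Q.indicator f y‖ ≤ ‖f y‖ = o(‖y - x‖)`).
* `isOpen_escape`, `mem_closure_escape`: the ESCAPE set (a coordinate strictly outside `[0, L]`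
  or a pair strictly closer than `b`; written inline) is an open subset of the complement of the
  free region `{all pairs > b} ∩ Λ_L^N`, and every non-free configuration is a limit of escape
  configurations (push a coordinate out of the closed box, or two touching spheres together).
* `psi_eq_zero_of_not_mem_free`, `fderiv_eq_zero_of_not_mem_free`: a FINITE-ENERGY trial state
  of a hard-core gas (`v = ⊤` on `[0, b]`) vanishes together with its derivative off the free
  region (it vanishes a.e. on the contact set, hence on the open escape set by continuity, hence
  on its closure; the derivative vanishes on the open escape set and is continuous).
* `kineticOn_indicator`, `normSq_indicator`, `density_indicator`: the energy density of
  `Q.indicator ψ` is `Q.indicator` of the energy density of `ψ`.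
* `kineticDensity_eq_kineticOn_one_add`, `interactionOn_succAbove_le`: splitting off particle `i`.
-/

noncomputable section

open MeasureTheory Filter Set Metric
open scoped ENNReal NNReal Topology

namespace Summit.AtomisticToContinuum.BoseEinsteinCondensation.Theorems.GroundStateRigidity

open Literature.MathematicalPhysics.QuantumManyBody.BoseGas

namespace SectorExclusion

/-! ### `C¹` surgery along clopen sets -/

section Surgery

variable {E F G : Type*} [NormedAddCommGroup E] [NormedAddCommGroup F] [NormedAddCommGroup G]

/-- **Clopen surgery, continuity.** If `g` is continuous, `Q`, `R` are disjoint open sets and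
`g = 0` outside `Q ∪ R`, then `Q.indicator g` is continuous. [folklore] -/
theorem continuous_indicator_of_cover {g : E → G}
    {Q R : Set E} (hg : Continuous g) (hQ : IsOpen Q) (hR : IsOpen R) (hQR : Disjoint Q R)
    (h0 : ∀ x, x ∉ Q → x ∉ R → g x = 0) : Continuous (Q.indicator g) := by
  refine continuous_iff_continuousAt.2 fun x => ?_
  by_cases hxQ : x ∈ Q
  · refine hg.continuousAt.congr_of_eventuallyEq ?_
    filter_upwards [hQ.mem_nhds hxQ] with y hy using indicator_of_mem hy g
  by_cases hxR : x ∈ R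
  · have h : Q.indicator g =ᶠ[𝓝 x] fun _ => (0 : G) := by
      filter_upwards [hR.mem_nhds hxR] with y hy
      exact indicator_of_notMem (Set.disjoint_right.1 hQR hy) g
    exact h.continuousAt
  · rw [ContinuousAt, indicator_of_notMem hxQ]
    refine squeeze_zero_norm (fun y => norm_indicator_le_norm_self g y) ?_
    have h := (hg.norm).continuousAt (x := x)
    rwa [ContinuousAt, h0 x hxQ hxR, norm_zero] at h

variable [NormedSpace ℝ E] [NormedSpace ℝ F]

/-- **Clopen surgery, derivative.** If `f` has derivative `f' x` everywhere, `Q`, `R` are disjoint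
open sets, and `f = 0`, `f' = 0` at every point outside `Q ∪ R`, then `Q.indicator f` has
derivative `Q.indicator f' x` at every `x`. [folklore] -/
theorem hasFDerivAt_indicator {f : E → F} {f' : E → E →L[ℝ] F} {Q R : Set E}
    (hf : ∀ x, HasFDerivAt f (f' x) x) (hQ : IsOpen Q) (hR : IsOpen R) (hQR : Disjoint Q R)
    (h0 : ∀ x, x ∉ Q → x ∉ R → f x = 0) (h0' : ∀ x, x ∉ Q → x ∉ R → f' x = 0) (x : E) :
    HasFDerivAt (Q.indicator f) (Q.indicator f' x) x := by
  by_cases hxQ : x ∈ Q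
  · rw [indicator_of_mem hxQ]
    refine (hf x).congr_of_eventuallyEq ?_
    filter_upwards [hQ.mem_nhds hxQ] with y hy
    rw [indicator_of_mem hy]
  rw [indicator_of_notMem hxQ]
  by_cases hxR : x ∈ R
  · have h : Q.indicator f =ᶠ[𝓝 x] fun _ => (0 : F) := by
      filter_upwards [hR.mem_nhds hxR] with y hy
      exact indicator_of_notMem (Set.disjoint_right.1 hQR hy) f
    exact (hasFDerivAt_const (0 : F) x).congr_of_eventuallyEq h
  · have h1 := (hf x).isLittleO
    rw [h0 x hxQ hxR, h0' x hxQ hxR] at h1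
    have h2 : (fun y => Q.indicator f y) =O[𝓝 x]
        (fun y => f y - 0 - (0 : E →L[ℝ] F) (y - x)) :=
      Asymptotics.IsBigO.of_bound 1 (Eventually.of_forall fun y => by
        simpa only [sub_zero, zero_apply, one_mul] using
          norm_indicator_le_norm_self f y)
    refine HasFDerivAt.of_isLittleO ((h2.trans_isLittleO h1).congr_left fun y => ?_)
    rw [indicator_of_notMem hxQ, sub_zero, zero_apply, sub_zero]

/-- **Clopen surgery lemma.** If `f` is `C¹`, `Q`, `R` are disjoint open sets and `f` and
`fderiv ℝ f` vanish at every point outside `Q ∪ R`, then `Q.indicator f` is `C¹` with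
`fderiv (Q.indicator f) = Q.indicator (fderiv f)`. [folklore] -/
theorem contDiff_indicator {f : E → F} {Q R : Set E} (hf : ContDiff ℝ 1 f) (hQ : IsOpen Q)
    (hR : IsOpen R) (hQR : Disjoint Q R) (h0 : ∀ x, x ∉ Q → x ∉ R → f x = 0)
    (h0' : ∀ x, x ∉ Q → x ∉ R → fderiv ℝ f x = 0) :
    ContDiff ℝ 1 (Q.indicator f) ∧
      ∀ x, fderiv ℝ (Q.indicator f) x = Q.indicator (fderiv ℝ f) x := by
  have hd : ∀ x, HasFDerivAt f (fderiv ℝ f x) x := fun x =>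
    ((hf.differentiable one_ne_zero) x).hasFDerivAt
  have hD := hasFDerivAt_indicator hd hQ hR hQR h0 h0'
  exact ⟨contDiff_one_iff_hasFDerivAt.2 ⟨_, continuous_indicator_of_cover
    (hf.continuous_fderiv one_ne_zero) hQ hR hQR h0', hD⟩, fun x => (hD x).fderiv⟩

/-- A point reached by a ray `X + t • w`, `t ∈ (0, 1)`, running inside `O` lies in the closure
of `O`. [folklore] -/
theorem mem_closure_of_ray {O : Set E} (X w : E) (hO : ∀ t : ℝ, t ∈ Ioo (0 : ℝ) 1 → X + t • w ∈ O) :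
    X ∈ closure O := by
  have hc : Tendsto (fun t : ℝ => X + t • w) (𝓝[>] 0) (𝓝 X) := by
    have h : Continuous fun t : ℝ => X + t • w := by fun_prop
    simpa using (h.tendsto 0).mono_left nhdsWithin_le_nhds
  exact mem_closure_of_tendsto hc
    (by filter_upwards [Ioo_mem_nhdsGT zero_lt_one] with t ht using hO t ht)

end Surgery

/-! ### The free region and its complement -/

variable {N : ℕ} {L b : ℝ} {v : ℝ → ℝ≥0∞}

/-- The ESCAPE set — a coordinate strictly outside `[0, L]`, or two particles strictly closer than
`b` (an open subset of the complement of the free region, written inline) — is open. [folklore] -/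
theorem isOpen_escape (N : ℕ) (L b : ℝ) :
    IsOpen {Y : Config N | (∃ (i : Fin N) (k : Fin 3), Y i k < 0 ∨ L < Y i k) ∨
      ∃ i j : Fin N, i ≠ j ∧ dist (Y i) (Y j) < b} := by
  have hc : ∀ (i : Fin N) (k : Fin 3), Continuous fun Y : Config N => Y i k := fun i k =>
    (PiLp.continuous_apply 2 _ k).comp (continuous_apply i)
  simp only [setOf_or, setOf_exists, setOf_and]
  refine IsOpen.union (isOpen_iUnion fun i => isOpen_iUnion fun k => ?_)
    (isOpen_iUnion fun i => isOpen_iUnion fun j => (isOpen_const).inter ?_)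
  · exact (isOpen_lt (hc i k) continuous_const).union (isOpen_lt continuous_const (hc i k))
  · exact isOpen_lt ((continuous_apply i).dist (continuous_apply j)) continuous_const

/-- Escape configurations are outside the box or have a pair at distance `< b`. [folklore] -/
theorem not_mem_boxN_or_of_mem_escape {Y : Config N}
    (hY : Y ∈ {Y : Config N | (∃ (i : Fin N) (k : Fin 3), Y i k < 0 ∨ L < Y i k) ∨
      ∃ i j : Fin N, i ≠ j ∧ dist (Y i) (Y j) < b}) :
    Y ∉ boxN N L ∨ ∃ i j : Fin N, i ≠ j ∧ dist (Y i) (Y j) < b := by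
  rcases hY with ⟨i, k, h⟩ | h
  · refine Or.inl fun hbox => ?_
    have h1 := hbox i k
    rcases h with h | h
    · exact lt_irrefl _ (h.trans h1.1)
    · exact lt_irrefl _ (h1.2.trans h)
  · exact Or.inr h

/-- **Every non-free configuration is a limit of escape configurations** (`b > 0`): push a
coordinate out of the closed box along a coordinate ray, or push particle `i` towards a particle
`j` at distance `≤ b`. [folklore] -/
theorem mem_closure_escape (hb : 0 < b) {X : Config N}
    (hX : X ∉ {Z : Config N | Z ∈ boxN N L ∧ ∀ i j : Fin N, i ≠ j → b < dist (Z i) (Z j)}) :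
    X ∈ closure {Y : Config N | (∃ (i : Fin N) (k : Fin 3), Y i k < 0 ∨ L < Y i k) ∨
      ∃ i j : Fin N, i ≠ j ∧ dist (Y i) (Y j) < b} := by
  by_cases hbox : X ∈ boxN N L
  · -- a touching pair
    have h : ∃ i j : Fin N, i ≠ j ∧ dist (X i) (X j) ≤ b := by
      by_contra h
      push Not at h
      exact hX ⟨hbox, fun i j hij => h i j hij⟩
    obtain ⟨i, j, hij, hd⟩ := h
    set w : Config N := Pi.single i (X j - X i) with hw
    refine mem_closure_of_ray X w fun t ht => Or.inr ⟨i, j, hij, ?_⟩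
    have hi : (X + t • w) i = X i + t • (X j - X i) := by
      simp [hw]
    have hj : (X + t • w) j = X j := by
      simp [hw, Pi.single_eq_of_ne hij.symm]
    rw [hi, hj, dist_eq_norm]
    have : X i + t • (X j - X i) - X j = (1 - t) • (X i - X j) := by
      simp only [sub_smul, one_smul, smul_sub]; abel
    rw [this, norm_smul, Real.norm_of_nonneg (by linarith [ht.2]), ← dist_eq_norm]
    calc (1 - t) * dist (X i) (X j) ≤ (1 - t) * b := by gcongr; linarith [ht.2]
      _ < b := by nlinarith [ht.1]
  · -- a coordinate outside the open box
    simp only [boxN, box, Set.mem_setOf_eq, not_forall, Set.mem_Ioo, not_and_or, not_lt] at hbox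
    obtain ⟨i, k, hk⟩ := hbox
    rcases hk with hk | hk
    · set w : Config N := Pi.single i (EuclideanSpace.single k (-1 : ℝ)) with hw
      refine mem_closure_of_ray X w fun t ht => Or.inl ⟨i, k, Or.inl ?_⟩
      have : (X + t • w) i k = X i k - t := by
        simp [hw]; ring
      rw [this]; linarith [ht.1]
    · set w : Config N := Pi.single i (EuclideanSpace.single k (1 : ℝ)) with hw
      refine mem_closure_of_ray X w fun t ht => Or.inl ⟨i, k, Or.inr ?_⟩
      have : (X + t • w) i k = X i k + t := by
        simp [hw]
      rw [this]; linarith [ht.1]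

/-! ### Finite-energy trial states vanish to first order off the free region -/

/-- A finite-energy trial state of a hard-core gas (`v = ⊤` on `[0, b]`) vanishes on the escape
set: off the box by the Dirichlet condition; on the open set `{|xᵢ - xⱼ| < b}` because it
vanishes a.e. on the contact set (`VanishOffFree.setLIntegral_trialState_eq_zero`) and is
continuous (open sets of positive measure). [folklore] -/
theorem psi_eq_zero_of_mem_escape (hcore : ∀ s : ℝ, s ∈ Set.Icc 0 b → v s = ⊤)
    (Φ : TrialState N L) (hE : energy v Φ < ⊤) {Y : Config N}
    (hY : Y ∈ {Y : Config N | (∃ (i : Fin N) (k : Fin 3), Y i k < 0 ∨ L < Y i k) ∨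
      ∃ i j : Fin N, i ≠ j ∧ dist (Y i) (Y j) < b}) :
    Φ.ψ Y = 0 := by
  rcases not_mem_boxN_or_of_mem_escape hY with h | ⟨i, j, hij, hd⟩
  · exact Φ.eq_zero Y h
  · set K : Set (Config N) := {X | ∃ i j : Fin N, i ≠ j ∧ dist (X i) (X j) ≤ b} with hK
    have hKv : ∀ X ∈ K, interaction v X = ⊤ := fun X ⟨_, _, hij, hd⟩ =>
      VanishOffFree.interaction_eq_top hcore hij hd
    have h0 := VanishOffFree.setLIntegral_trialState_eq_zero
      (VanishOffFree.measurableSet_contactSet N b) hKv Φ hE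
    have hm : Measurable fun X => (‖Φ.ψ X‖₊ : ℝ≥0∞) ^ 2 :=
      (Φ.contDiff.continuous.measurable.nnnorm.coe_nnreal_ennreal).pow_const 2
    have hae := (lintegral_eq_zero_iff hm).1 h0
    rw [Filter.EventuallyEq, ae_restrict_iff' (VanishOffFree.measurableSet_contactSet N b)] at hae
    -- the open set `{|xᵢ - xⱼ| < b} ∩ {ψ ≠ 0}` is null, hence empty
    set O : Set (Config N) := {X | dist (X i) (X j) < b ∧ Φ.ψ X ≠ 0} with hO
    have hOo : IsOpen O := by
      rw [hO, setOf_and]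
      exact (isOpen_lt ((continuous_apply i).dist (continuous_apply j)) continuous_const).inter
        (isOpen_ne_fun Φ.contDiff.continuous continuous_const)
    have hOnull : volume O = 0 := by
      refine measure_mono_null (fun X hX => ?_) (ae_iff.1 hae)
      intro himp
      have h2 := himp ⟨i, j, hij, hX.1.le⟩
      simp only [Pi.zero_apply, ne_eq, OfNat.ofNat_ne_zero, not_false_eq_true, pow_eq_zero_iff,
        ENNReal.coe_eq_zero, nnnorm_eq_zero] at h2
      exact hX.2 h2
    by_contra hne
    exact (hOo.measure_ne_zero volume ⟨Y, hd, hne⟩) hOnull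

/-- **A finite-energy trial state of a hard-core gas vanishes off the free region** (`b > 0`):
it vanishes on the escape set, which accumulates at every non-free configuration. [folklore] -/
theorem psi_eq_zero_of_not_mem_free (hb : 0 < b) (hcore : ∀ s : ℝ, s ∈ Set.Icc 0 b → v s = ⊤)
    (Φ : TrialState N L) (hE : energy v Φ < ⊤) {X : Config N}
    (hX : X ∉ {Z : Config N | Z ∈ boxN N L ∧ ∀ i j : Fin N, i ≠ j → b < dist (Z i) (Z j)}) :
    Φ.ψ X = 0 := by
  have hZ : IsClosed (Φ.ψ ⁻¹' {0}) := isClosed_singleton.preimage Φ.contDiff.continuous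
  refine hZ.closure_subset_iff.2 (fun Y hY => ?_) (mem_closure_escape hb hX)
  exact psi_eq_zero_of_mem_escape hcore Φ hE hY

/-- **… and so does its derivative**: `fderiv ℝ Φ.ψ = 0` on the open escape set (where `Φ.ψ`
vanishes identically), hence on its closure by continuity of the derivative. [folklore] -/
theorem fderiv_eq_zero_of_not_mem_free (hb : 0 < b)
    (hcore : ∀ s : ℝ, s ∈ Set.Icc 0 b → v s = ⊤) (Φ : TrialState N L) (hE : energy v Φ < ⊤)
    {X : Config N} (hX : X ∉ {Z : Config N | Z ∈ boxN N L ∧ ∀ i j : Fin N, i ≠ j → b < dist (Z i) (Z j)}) :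
    fderiv ℝ Φ.ψ X = 0 := by
  have hZ : IsClosed ((fderiv ℝ Φ.ψ) ⁻¹' {0}) :=
    isClosed_singleton.preimage (Φ.contDiff.continuous_fderiv one_ne_zero)
  refine hZ.closure_subset_iff.2 (fun Y hY => ?_) (mem_closure_escape hb hX)
  have h : Φ.ψ =ᶠ[𝓝 Y] fun _ => (0 : ℂ) := by
    filter_upwards [(isOpen_escape N L b).mem_nhds hY] with Z hZ
    exact psi_eq_zero_of_mem_escape hcore Φ hE hZ
  show fderiv ℝ Φ.ψ Y = 0
  rw [h.fderiv_eq, fderiv_const_apply]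

/-! ### Energy densities of indicator states -/

/-- The kinetic energy density of a group for `Q.indicator ψ` is `Q.indicator` of that of `ψ`,
once `fderiv (Q.indicator ψ) = Q.indicator (fderiv ψ)`. [folklore] -/
theorem kineticOn_indicator {n M : ℕ} (ι : Fin n → Fin M) {ψ : Config M → ℂ} {Q : Set (Config M)}
    (hD : ∀ X, fderiv ℝ (Q.indicator ψ) X = Q.indicator (fderiv ℝ ψ) X) (X : Config M) :
    kineticOn ι (Q.indicator ψ) X = Q.indicator (kineticOn ι ψ) X := by
  unfold kineticOn
  rw [hD X]
  by_cases hX : X ∈ Q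
  · simp only [indicator_of_mem hX]
  · simp only [indicator_of_notMem hX, zero_apply, nnnorm_zero,
      ENNReal.coe_zero, ne_eq, OfNat.ofNat_ne_zero, not_false_eq_true, zero_pow,
      Finset.sum_const_zero]

/-- `|Q.indicator ψ|² = Q.indicator |ψ|²`. [folklore] -/
theorem normSq_indicator {M : ℕ} (ψ : Config M → ℂ) (Q : Set (Config M)) (X : Config M) :
    (‖Q.indicator ψ X‖₊ : ℝ≥0∞) ^ 2 = Q.indicator (fun Y => (‖ψ Y‖₊ : ℝ≥0∞) ^ 2) X := by
  by_cases hX : X ∈ Q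
  · simp only [indicator_of_mem hX]
  · simp only [indicator_of_notMem hX, nnnorm_zero, ENNReal.coe_zero, ne_eq, OfNat.ofNat_ne_zero,
      not_false_eq_true, zero_pow]

/-- The energy density of `Q.indicator ψ` is `Q.indicator` of the energy density of `ψ`.
[folklore] -/
theorem density_indicator {M : ℕ} (v : ℝ → ℝ≥0∞) {ψ : Config M → ℂ} {Q : Set (Config M)}
    (hD : ∀ X, fderiv ℝ (Q.indicator ψ) X = Q.indicator (fderiv ℝ ψ) X) (X : Config M) :
    kineticDensity (Q.indicator ψ) X + interaction v X * (‖Q.indicator ψ X‖₊ : ℝ≥0∞) ^ 2 =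
      Q.indicator (fun Y => kineticDensity ψ Y + interaction v Y * (‖ψ Y‖₊ : ℝ≥0∞) ^ 2) X := by
  have hk : kineticDensity (Q.indicator ψ) X = Q.indicator (kineticDensity ψ) X :=
    kineticOn_indicator id hD X
  rw [hk, normSq_indicator]
  by_cases hX : X ∈ Q
  · simp only [indicator_of_mem hX]
  · simp only [indicator_of_notMem hX, mul_zero, add_zero]

/-! ### Splitting off one particle -/

/-- `|∇Ψ|² = |∇ᵢΨ|² + ∑_{j ≠ i} |∇ⱼΨ|²`: the kinetic energy density splits into particle `i`'s
(the group `Fin 1 → {i}`) and the others' (the group `i.succAbove`). [folklore] -/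
theorem kineticDensity_eq_kineticOn_one_add {M : ℕ} (i : Fin (M + 1)) (ψ : Config (M + 1) → ℂ)
    (X : Config (M + 1)) :
    kineticDensity ψ X = kineticOn (fun _ : Fin 1 => i) ψ X + kineticOn i.succAbove ψ X := by
  unfold kineticDensity kineticOn
  rw [Fin.sum_univ_succAbove _ i, Fin.sum_univ_one]

/-- Particle `i`'s kinetic energy density is the `i`-th partial gradient squared. [folklore] -/
theorem kineticOn_one {M : ℕ} (i : Fin M) (ψ : Config M → ℂ) (X : Config M) :
    kineticOn (fun _ : Fin 1 => i) ψ X =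
      ∑ k : Fin 3, (‖fderiv ℝ ψ X (Pi.single i (EuclideanSpace.single k (1 : ℝ)))‖₊ : ℝ≥0∞) ^ 2 := by
  unfold kineticOn
  rw [Fin.sum_univ_one]

/-- Dropping the interactions of particle `i` decreases the interaction (`v ≥ 0`):
`∑_{j<j', j,j' ≠ i} v ≤ ∑_{j<j'} v`. [folklore] -/
theorem interactionOn_succAbove_le {M : ℕ} (i : Fin (M + 1)) (v : ℝ → ℝ≥0∞) (X : Config (M + 1)) :
    interactionOn i.succAbove v X ≤ interaction v X := by
  unfold interactionOn interaction
  simp only [Finset.sum_filter]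
  rw [Fin.sum_univ_succAbove _ i]
  refine le_add_left (Finset.sum_le_sum fun l _ => ?_)
  rw [Fin.sum_univ_succAbove _ i]
  refine le_add_left (Finset.sum_le_sum fun l' _ => ?_)
  simp only [(Fin.strictMono_succAbove i).lt_iff_lt]
  exact le_rfl

end SectorExclusion

end Summit.AtomisticToContinuum.BoseEinsteinCondensation.Theorems.GroundStateRigidity

end
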